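import Mathlib
import Literature.Computability.AlgebraicComplexity.HessianAtOrigin
import Summits.ValiantsHypothesis.ValiantsHypothesis.Theorems.GrenetZeonTwoDimCoefficientsDefs
import Summits.ValiantsHypothesis.ValiantsHypothesis.Theorems.GrenetZeonTwoDimCoefficientsScalingClosureShadow
import Summits.ValiantsHypothesis.ValiantsHypothesis.Theorems.GrenetZeonTwoDimCoefficientsScalingShadowFamily
import Summits.ValiantsHypothesis.ValiantsHypothesis.Theorems.GrenetZeonTwoDimCoefficientsScalingTorusClosure
import Summits.ValiantsHypothesis.ValiantsHypothesis.Theorems.GrenetZeonTwoDimCoefficientsScalingTorusPermanent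

/-!
# Crux `GrenetZeon.TwoDimCoefficients` (stmt-ValiantsHypothesis-8062), stub `stub_dualUnipotent`:
# scaling-closure — ASSEMBLY: torus-unstable companions ⇒ `n² ≤ 2m`

The whole scaling-closure method by name: ✓ `exists_shadowFamily` (scaling degeneration: special fibre =
shadow `Φ = c + β⁻¹·per_n + companions`, Mignon–Ressayre on the slices) ⟶ ✓ `rank_hess0_shadow_le` (Hessian
bound `2m` at the smooth zeros of `Φ`) ⟶ ✓ `torusClosure` (second degeneration along a one-parameter subgroup
`z_{ab} ↦ d^{u_a+v_b} z_{ab}`, `Σu + Σv = 0`, of the stabiliser torus of `per_n`: the companion pieces of positive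
weight die, `Φ₀ = c + β⁻¹·per_n` is invariant by ✓ `eval_torus_perLevel_of_sum_eq_zero`) ⟶
✓ `sq_le_of_smoothZeroBound_perLevel` (`n² ≤ 2m`):

* ★★ `sq_le_two_mul_of_torusUnstableCompanions` — every unipotent dual representation of `per_n` (`n ≥ 3`,
  `deg D_j ≤ j·n`) whose companion sum splits into pieces of POSITIVE torus weight obeys `n² ≤ 2m`.

So the residual enemy of the method (memo SIXTEENTH-HAND.md, R3) is a representation with a BALANCED
(torus-weight-zero, "k-magic") companion — the IMM witness of PROFILE-BARRIER is of that kind.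

HONEST FRAMING: a conditional-on-shape rung; the stub `DualUnipotentBound`, the crux and `VP ≠ VNP` remain open.

References: T. Mignon, N. Ressayre, Int. Math. Res. Not. 2004:79, Thm. 1.1; D. Mumford, J. Fogarty, F. Kirwan,
*Geometric Invariant Theory*, Ch. 2 §1 (one-parameter subgroups; elementary use only).
-/

-- single-conjunct layout `Summits/ValiantsHypothesis/ValiantsHypothesis`: the duplicated namespace
-- component is mandated by the tree.
set_option linter.dupNamespace false
set_option autoImplicit false

noncomputable section

namespace Summit.ValiantsHypothesis.ValiantsHypothesis.Theorems.GrenetZeonTwoDimCoefficients.ScalingClosure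

open MvPolynomial Matrix
open Literature.Computability.AlgebraicComplexity
open Summit.ValiantsHypothesis.ValiantsHypothesis.Cruxes.TwoDimCoefficients.DimTwoCases

/-! ### Assembly: torus-unstable companions -/

section Assembly

/-- ★★ **Torus-unstable companions ⇒ Mignon–Ressayre's bound.**  Let `per_n = α·c + β·tr(adj A·B)` be a
unipotent dual representation (`det A = c ≠ 0`, `A, B` affine `m × m`, `n = k + 3`, `m ≥ 2`) whose coefficient
polynomials `D_j = [X^j] det(X·B + A)` satisfy `deg D_j ≤ j·n` (`j ≥ 2`), and suppose the companion sum
`Σ_{2 ≤ j ≤ m} [D_j]_{jn}` splits as `Σ_{ι ∈ J} ψ_ι` with every piece of POSITIVE weight `e_ι ≥ 1` for one integral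
torus weight `w_{ab} = u_a + v_b`, `Σu + Σv = 0` (i.e. the companions are unstable for a one-parameter subgroup of
the stabiliser torus of `per_n`).  Then `n² ≤ 2m`.
[cite: MignonRessayre2004, Thm. 1.1 — via the tree; folklore degenerations] -/
theorem sq_le_two_mul_of_torusUnstableCompanions {k m : ℕ} {ι : Type*} (A B : AffMat (k + 3) m)
    (hA : IsAffine A) (hB : IsAffine B) (α β c : ℂ) (hc : c ≠ 0) (hβ : β ≠ 0)
    (hdet : A.det = MvPolynomial.C c)
    (hper : perPoly (Fin (k + 3)) ℂ =
      MvPolynomial.C α * A.det + MvPolynomial.C β * (A.adjugate * B).trace)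
    (hm2 : 2 ≤ m) (D : ℕ → MvPolynomial (Fin (k + 3) × Fin (k + 3)) ℂ)
    (hD : ∀ j, D j = (det ((Polynomial.X : Polynomial (MvPolynomial (Fin (k + 3) × Fin (k + 3)) ℂ)) •
      B.map Polynomial.C + A.map Polynomial.C)).coeff j)
    (hdeg : ∀ j, 2 ≤ j → ∀ d, j * (k + 3) < d → homogeneousComponent d (D j) = 0)
    (u v : Fin (k + 3) → ℤ) (huv : ∑ a, u a + ∑ b, v b = 0)
    (J : Finset ι) (ψ : ι → MvPolynomial (Fin (k + 3) × Fin (k + 3)) ℂ) (e : ι → ℕ)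
    (he : ∀ j ∈ J, 1 ≤ e j)
    (hψ : ∀ j ∈ J, ∀ d : ℂ, d ≠ 0 → ∀ z : Fin (k + 3) × Fin (k + 3) → ℂ,
      eval (fun p : Fin (k + 3) × Fin (k + 3) => d ^ (u p.1 + v p.2) * z p) (ψ j) =
        d ^ (e j) * eval z (ψ j))
    (hsplit : (∑ j ∈ Finset.range (m + 1),
        if 2 ≤ j then homogeneousComponent (j * (k + 3)) (D j) else 0) = ∑ j ∈ J, ψ j) :
    (k + 3) ^ 2 ≤ 2 * m := by
  classical
  obtain ⟨P, h0, hMR⟩ := exists_shadowFamily A B hA hB α β c hc hβ hdet hper (by omega) hm2 D hD hdeg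
  -- the shadow is `Φ₀ + Σ ψ` with `Φ₀ = c + β⁻¹ per`
  have h0' : ∀ z : Fin (k + 3) × Fin (k + 3) → ℂ,
      eval (fun o : Option (Fin (k + 3) × Fin (k + 3)) => o.elim (0 : ℂ) z) P =
        eval z (MvPolynomial.C c + MvPolynomial.C β⁻¹ * perPoly (Fin (k + 3)) ℂ + ∑ j ∈ J, ψ j) := by
    intro z
    rw [h0 z, hsplit]
  -- smooth-zero bound on the shadow
  have hshadow : ∀ z : Fin (k + 3) × Fin (k + 3) → ℂ,
      eval z (MvPolynomial.C c + MvPolynomial.C β⁻¹ * perPoly (Fin (k + 3)) ℂ + ∑ j ∈ J, ψ j) = 0 →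
      (∃ i, eval z (pderiv i (MvPolynomial.C c + MvPolynomial.C β⁻¹ * perPoly (Fin (k + 3)) ℂ +
        ∑ j ∈ J, ψ j)) ≠ 0) →
      (hess0 (transl z (MvPolynomial.C c + MvPolynomial.C β⁻¹ * perPoly (Fin (k + 3)) ℂ +
        ∑ j ∈ J, ψ j))).rank ≤ 2 * m := by
    rintro z hz ⟨i, hi⟩
    exact rank_hess0_shadow_le P _ (2 * m) h0' hMR z hz i hi
  -- torus degeneration to `Φ₀`
  have hΦ₀ := torusClosure (MvPolynomial.C c + MvPolynomial.C β⁻¹ * perPoly (Fin (k + 3)) ℂ) J ψ e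
    (fun p : Fin (k + 3) × Fin (k + 3) => u p.1 + v p.2) (2 * m) he
    (fun d hd z => eval_torus_perLevel_of_sum_eq_zero c β⁻¹ u v huv hd z) hψ hshadow
  exact sq_le_of_smoothZeroBound_perLevel c β⁻¹ hc (inv_ne_zero hβ) hΦ₀

end Assembly

end Summit.ValiantsHypothesis.ValiantsHypothesis.Theorems.GrenetZeonTwoDimCoefficients.ScalingClosure

end
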